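import Summits.BirchSwinnertonDyer.Rank1Residual.X11a.ChainAnyLevel
import HarnessLib

/-!
# Class X11a: the END STATE on the tree (gen 20) — the class statement of record from published
# facts plus exactly three displayed inputs (cell `b2b-bsdres`, unit `b2b-bsdres-x11a`)

HONEST FRAMING (run/shared/lean/b2b/bsd-rank1-residual/, verbatim in every file): the goal of the
cell is to DELETE the COMBINATION-SHAPED residual classes of the Birch–Swinnerton-Dyer formula for
ALL analytic-rank `≤ 1` elliptic curves over `ℚ` — "full BSD formula for every rank `≤ 1` curve in
class `C`" assembled STRICTLY from published theorems — so that the rank-`≤ 1` remainder becomes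
exactly the CONSTRUCTION-SHAPED classes, which are TYPED (missing-input `Prop`s), NOT attempted.
This is not "finishing BSD". Research route; NO CLAIM BEYOND STATED CLASSES. Theorems only; every
published input is an explicit NAMED-FACT hypothesis; no new definition, no new fact; nothing booked.

WHAT. `X11a.Target` (`X11a/Cells.lean`: `BSD(E,p)` for every globally minimal `E/ℚ` with
`r_an ≤ 1` and `(E,p) ∈ X11a` — `r_an = 0`, `p` odd, `p ‖ N`, `E[p]` irreducible, no (ram) prime)
splits as `TargetThree ∧ TargetPub ∧ TargetLeaf` (`target_iff_targets`); `TargetPub` is closed in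
print (Wuthrich 2014 Prop. 21, `targetPub_of_published`). With the gen-20 chain of record
(`forall_bsdp_of_namedFacts_ofLevel_heightFree`, 12 named facts, `X11a/ChainAnyLevel.lean`) the
leaf needs, per pair, ONLY the certificate `MuAnZeroAt W p` when `ρ̄_{E,p}` is surjective, and the
typed input `X2.MazurMainConjectureAt W p` (Mazur's main conjecture at the pair, class-agnostic,
eisenstein-p2) when it is not. THIS FILE assembles the end state:

* `targetLeaf_of_endState` — `TargetLeaf` ⇐ the 12 named facts + (`MuAnZeroAt` on `Leaf ∧ Surj`)
  + (`X2.MazurMainConjectureAt` on `Leaf ∧ ¬Surj`);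
* `target_of_endState` — **`X11a.Target` ⇐ 13 NAMED PUBLISHED FACTS** (the 12 + Wuthrich Prop. 21
  `sha_dvd_analyticSha` for `CellPub`) **+ THREE DISPLAYED INPUTS**: `TargetThree` (the `p = 3`
  sub-cell, x11b/x11c's typed domain), the per-pair certificate `μ^an(E,p) = 0` on the surjective
  leaf (class level: Greenberg's `μ`-conjecture for irreducible `E[p]`), and Mazur's main conjecture
  at the non-surjective leaf pairs;
* `target_of_endState_sharp` — the same with BDMTV 2019 Thm. 1.2 (`hB`, 14th named fact): the
  non-surjective leaf input is needed ONLY at `p ∈ {5, 7}` with `p ∣ ord_p(Δ_min)` (x11c's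
  `ClassX11a.surj_of_eleven_le` / `ClassX11a.surj_of_not_dvd`); no pair of the lane's `N < 2·10⁴`
  residue list lies there (X11a/Cells.lean), but the set is not empty in general (images `5S4`, `5Ns`,
  `7Ns`). ERRATUM (x11a gen 22, HOME/b2b-bsdres-x11a/g22/NONSURJ-LEAF-CENSUS.md): X11a leaf pairs
  with non-surjective image DO occur in Cremona's range — 56 at `p = 5` below `5·10⁵` (13 of type
  `5Ns`, 43 of type `5S4`), the smallest `6480d1 @ 5` (below `2·10⁴`; closed per pair in the lane's
  sweep by Cha 2005 / Kolyvagin + Jetchev 2008, 38 of the 56 being residual there); per-pair suppliers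
  of input (3) for them are in `X11a/CMPartner.lean` and `X11a/NonSurjectiveLeaf.lean`.

No label change by this file (cell lead / referee). Nothing here is new mathematics: it is the
bookkeeping conjunction of theorems already in the tree, stated once so that the class row can cite
ONE declaration.

References: [Wuthrich2014] Prop. 21; [EmertonPollackWeston2006] Thm. 1, 3.1.1, 5.1.3; [Wan2015]
Thm. 4; [SteinWuthrich2013] Thm. 6.1; [BalakrishnanEtAl2019] Thm. 1.2; [SerreInventiones1972]
§1.12, §2.4 Prop. 15; HOME/b2b-bsdres-x11a/REPORT-g20.md.
-/

noncomputable section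

open scoped Classical

open WeierstrassCurve Literature.NumberTheory.EllipticCurves
  Literature.NumberTheory.EllipticCurves.ModularForms
  Literature.NumberTheory.EllipticCurves.Rank1Residual
  Literature.NumberTheory.EllipticCurves.Rank1Residual.Typed
  Literature.NumberTheory.EllipticCurves.Wuthrich2014
  Literature.NumberTheory.EllipticCurves.SteinWuthrich2013
  Literature.NumberTheory.EllipticCurves.GreenbergVatsal2000
  Literature.NumberTheory.EllipticCurves.EmertonPollackWeston2006
  Literature.NumberTheory.EllipticCurves.BalakrishnanEtAl2019
  Summit.BirchSwinnertonDyer.Rank1Residual.RankZeroHeightFree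

set_option autoImplicit false

namespace Summit.BirchSwinnertonDyer.Rank1Residual.X11a

open Chain

/-- **The X11a leaf target from the end-state inputs**: the 12 named published facts of the chain
of record, the per-pair certificate `MuAnZeroAt W p` on the SURJECTIVE leaf pairs
(`forall_bsdp_of_namedFacts_ofLevel_heightFree`), and Mazur's main conjecture at the pair
(`X2.MazurMainConjectureAt`, the leaf's typed input) on the NON-surjective ones
(`bsdp_of_mazurMainConjectureAt_heightFree`, modularity's two consequences derived from `hNf`).
[cite: EmertonPollackWeston2006, Thm. 1, Thm. 3.1.1, Thm. 5.1.3] [cite: Wan2015, Thm. 4]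
[cite: SteinWuthrich2013, Thm. 6.1 (p. 20)] [cite: BreuilConradDiamondTaylor2001, Thm. A and p. 845 (2) ⇒ (6)] -/
theorem targetLeaf_of_endState (hNf : exists_isNewformOf)
    (h311 : thm311_cotorsion_weightK_member_ofLevel) (hT1a : thm1_muAlg_of_weightK_member_ofLevel)
    (hT2 : Wan2015.thm4_rational_weightK_member_of_bdd_ofLevel)
    (hT1b : thm513_transfer_from_weightK_member_of_bdd_ofLevel)
    (h61 : DeligneSerre1974.thm61_exists_adicGaloisRep) (h326 : Hida2000_thm326_ordinary)
    (hKato : kato_charIdeal_dvd_multiplicative_of_surjective)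
    (hJs : thm61_splitMultiplicative) (hJn : thm61_nonsplitMultiplicative)
    (hGZK : rank_eq_analyticRank_of_analyticRank_le_one)
    (hGS : ∀ (W : WeierstrassCurve ℚ) [W.IsElliptic] [W.IsGloballyMinimal] (p : ℕ) [Fact p.Prime],
      greenberg_stevens (W := W) (p := p))
    (hμ : ∀ (W : WeierstrassCurve ℚ) [W.IsElliptic] [W.IsGloballyMinimal] (p : ℕ) [Fact p.Prime],
      Leaf W p → Surj W p → MuAnZeroAt W p)
    (hMC : ∀ (W : WeierstrassCurve ℚ) [W.IsElliptic] [W.IsGloballyMinimal] (p : ℕ) [Fact p.Prime],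
      Leaf W p → ¬ Surj W p → X2.MazurMainConjectureAt W p) :
    TargetLeaf := by
  intro W _ _ p _ hL
  by_cases hsurj : Surj W p
  · exact forall_bsdp_of_namedFacts_ofLevel_heightFree hNf h311 hT1a hT2 hT1b h61 h326 hKato hJs hJn
      hGZK hGS W p hL.1 hL.2.1 hsurj (hμ W p hL hsurj)
  · exact bsdp_of_mazurMainConjectureAt_heightFree hJs hJn hGZK
      (hasEntireLFunction_rat_of_exists_isNewformOf hNf)
      (nonempty_modularParametrizationData_of_exists_isNewformOf hNf
        IsNewformOf.exists_maninConstant_ne_zero_holds)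
      (hGS W p) hL.1 (hMC W p hL hsurj)

/-- **X11a — END STATE ON THE TREE (gen 20).** The class statement of record `X11a.Target`
(`BSD(E,p)` at every `(E,p) ∈ X11a`) follows from **13 NAMED PUBLISHED FACTS** — modularity
(`hNf : exists_isNewformOf`), EPW 2006 Thm 3.1.1 / Thm 1 / Thm 5.1.3 (`h311`, `hT1a`, `hT1b`, any
tame level), Wan 2015 Thm 4 rational (`hT2`, any tame level), Deligne–Serre 6.1 (`h61`), Hida/Wiles
3.26 (`h326`), Kato–Wuthrich (`hKato`), Stein–Wuthrich 2013 Thm 6.1 ×2 (`hJs`, `hJn`), GZK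
(`hGZK`), Greenberg–Stevens (`hGS`), Wuthrich 2014 Prop. 21 (`hWu`) — **and exactly THREE
DISPLAYED INPUTS**: (1) `TargetThree` — the `p = 3` sub-cell (x11b/x11c's typed domain,
`Typed/X11Three.lean`); (2) the per-pair certificate `μ^an(E,p) = 0` (`MuAnZeroAt`, a finite
modular-symbol computation; class level = Greenberg's `μ`-conjecture for irreducible `E[p]`, OPEN)
on the surjective leaf pairs; (3) Mazur's cyclotomic main conjecture at the pair
(`X2.MazurMainConjectureAt`, typed, class-agnostic) on the non-surjective leaf pairs. Nothing else.
No label change (cell lead / referee). [cite: Wuthrich2014, Prop. 21 (p. 400)]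
[cite: EmertonPollackWeston2006, Thm. 1, Thm. 3.1.1, Thm. 5.1.3] [cite: Wan2015, Thm. 4]
[cite: SteinWuthrich2013, Thm. 6.1 (p. 20)] -/
theorem target_of_endState (hNf : exists_isNewformOf)
    (h311 : thm311_cotorsion_weightK_member_ofLevel) (hT1a : thm1_muAlg_of_weightK_member_ofLevel)
    (hT2 : Wan2015.thm4_rational_weightK_member_of_bdd_ofLevel)
    (hT1b : thm513_transfer_from_weightK_member_of_bdd_ofLevel)
    (h61 : DeligneSerre1974.thm61_exists_adicGaloisRep) (h326 : Hida2000_thm326_ordinary)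
    (hKato : kato_charIdeal_dvd_multiplicative_of_surjective)
    (hJs : thm61_splitMultiplicative) (hJn : thm61_nonsplitMultiplicative)
    (hGZK : rank_eq_analyticRank_of_analyticRank_le_one)
    (hGS : ∀ (W : WeierstrassCurve ℚ) [W.IsElliptic] [W.IsGloballyMinimal] (p : ℕ) [Fact p.Prime],
      greenberg_stevens (W := W) (p := p))
    (hWu : sha_dvd_analyticSha)
    (h3 : TargetThree)
    (hμ : ∀ (W : WeierstrassCurve ℚ) [W.IsElliptic] [W.IsGloballyMinimal] (p : ℕ) [Fact p.Prime],
      Leaf W p → Surj W p → MuAnZeroAt W p)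
    (hMC : ∀ (W : WeierstrassCurve ℚ) [W.IsElliptic] [W.IsGloballyMinimal] (p : ℕ) [Fact p.Prime],
      Leaf W p → ¬ Surj W p → X2.MazurMainConjectureAt W p) :
    Target :=
  (target_iff_targetThree_and_targetLeaf hWu hGZK (hasEntireLFunction_rat_of_exists_isNewformOf hNf)).mpr
    ⟨h3, targetLeaf_of_endState hNf h311 hT1a hT2 hT1b h61 h326 hKato hJs hJn hGZK hGS hμ hMC⟩

/-- **X11a — END STATE, sharp form**: with BDMTV 2019 Thm. 1.2 (`hB`, a 14th named fact) the
non-surjective leaf input (3) is needed ONLY at the pairs with `p ∈ {5, 7}` AND `p ∣ ord_p(Δ_min)`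
— at `p ≥ 11` an irreducible `E[p]` on X11a is surjective (x11c's `ClassX11a.surj_of_eleven_le`),
and at `p ∤ ord_p(Δ_min)` inertia at `p` supplies a transvection (`ClassX11a.surj_of_not_dvd`,
Serre 1972 §1.12 / §2.4). No pair of the lane's `N < 2·10⁴` residue list lies there; the set is
not empty — ERRATUM (x11a gen 22): in Cremona's range it holds 56 X11a pairs, all at `p = 5` (13
`5Ns` + 43 `5S4`; smallest `6480d1 @ 5`), see `X11a/NonSurjectiveLeaf.lean`.
[cite: BalakrishnanEtAl2019, §1 Thm. 1.2 (arXiv:1711.05846 p. 2)]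
[cite: SerreInventiones1972, §1.12 (Cor. of Prop. 13), §2.4 Prop. 15]
[cite: Wuthrich2014, Prop. 21 (p. 400)] [cite: EmertonPollackWeston2006, Thm. 1, Thm. 3.1.1, Thm. 5.1.3] -/
theorem target_of_endState_sharp (hNf : exists_isNewformOf)
    (h311 : thm311_cotorsion_weightK_member_ofLevel) (hT1a : thm1_muAlg_of_weightK_member_ofLevel)
    (hT2 : Wan2015.thm4_rational_weightK_member_of_bdd_ofLevel)
    (hT1b : thm513_transfer_from_weightK_member_of_bdd_ofLevel)
    (h61 : DeligneSerre1974.thm61_exists_adicGaloisRep) (h326 : Hida2000_thm326_ordinary)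
    (hKato : kato_charIdeal_dvd_multiplicative_of_surjective)
    (hJs : thm61_splitMultiplicative) (hJn : thm61_nonsplitMultiplicative)
    (hGZK : rank_eq_analyticRank_of_analyticRank_le_one)
    (hGS : ∀ (W : WeierstrassCurve ℚ) [W.IsElliptic] [W.IsGloballyMinimal] (p : ℕ) [Fact p.Prime],
      greenberg_stevens (W := W) (p := p))
    (hWu : sha_dvd_analyticSha) (hB : thm12_not_le_normalizer_splitCartan)
    (h3 : TargetThree)
    (hμ : ∀ (W : WeierstrassCurve ℚ) [W.IsElliptic] [W.IsGloballyMinimal] (p : ℕ) [Fact p.Prime],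
      Leaf W p → Surj W p → MuAnZeroAt W p)
    (hMC : ∀ (W : WeierstrassCurve ℚ) [W.IsElliptic] [W.IsGloballyMinimal] (p : ℕ) [Fact p.Prime],
      Leaf W p → ¬ Surj W p → (p = 5 ∨ p = 7) → p ∣ padicValInt p W.minimalDiscriminantInt →
        X2.MazurMainConjectureAt W p) :
    Target := by
  refine target_of_endState hNf h311 hT1a hT2 hT1b h61 h326 hKato hJs hJn hGZK hGS hWu h3 hμ ?_
  intro W _ _ p _ hL hns
  have hprime : p.Prime := Fact.out
  have h5 : 5 ≤ p := hL.2.1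
  -- `p ≥ 11` would force surjectivity (BDMTV)
  have h11 : p < 11 := by
    by_contra h
    exact hns (ClassX11a.surj_of_eleven_le W p hB hL.1 (by omega))
  -- `p ∤ ord_p(Δ_min)` would force surjectivity (Serre)
  have hdvd : p ∣ padicValInt p W.minimalDiscriminantInt := by
    by_contra h
    exact hns (ClassX11a.surj_of_not_dvd W p hL.1 h)
  have hp57 : p = 5 ∨ p = 7 := by
    interval_cases p
    · exact Or.inl rfl
    · exact absurd hprime (by decide)
    · exact Or.inr rfl
    · exact absurd hprime (by decide)
    · exact absurd hprime (by decide)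
    · exact absurd hprime (by decide)
  exact hMC W p hL hns hp57 hdvd

end Summit.BirchSwinnertonDyer.Rank1Residual.X11a

end
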